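import Mathlib.MeasureTheory.Measure.Lebesgue.EqHaar
import Mathlib.MeasureTheory.Integral.Bochner.Basic
import Mathlib.LinearAlgebra.Matrix.Block
import HarnessLib

/-!
# The suffix-sum map `u ↦ (∑_{a ≥ J} uₐ)_J` on `ℝᵐ` preserves Lebesgue measure

Analysis/Matrix support file (everything proved apart from the one definition `suffixSum`).
In the Osterwalder–Schrader continuation (Comm. Math. Phys. 42 (1975), Ch. V–VI) the times of the
points of a cluster are *suffix sums* of the gaps (`OSSkeletonFunctional.gapTimes`/`shTimes`); to
pass between integrals over the gaps and integrals over the point times one needs that this linear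
map is volume preserving: its matrix is upper triangular with unit diagonal, so `det = 1`
(`det_suffixSum`), hence `Measure.map suffixSum volume = volume` (`measurePreserving_suffixSum`)
and, `suffixSum` being a linear homeomorphism (`suffixSumEquiv`), integrals transform by
`integral_comp_suffixSum`.

## References

* K. Osterwalder, R. Schrader, *Axioms for Euclidean Green's functions II*, Comm. Math. Phys.
  42 (1975) 281–305, Ch. VI.1. [OsterwalderSchraderCMP1975]
-/

noncomputable section

open MeasureTheory Matrix

namespace Literature.Analysis.Matrix

variable (m : ℕ)

/-- The **suffix-sum map** `(S u)_J = ∑_{a ≥ J} uₐ` on `ℝᵐ`. [folklore] -/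
def suffixSum : (Fin m → ℝ) →ₗ[ℝ] (Fin m → ℝ) :=
  LinearMap.pi fun J : Fin m => ∑ a ∈ Finset.univ.filter (fun a : Fin m => J ≤ a), LinearMap.proj a

/-- Values of the suffix-sum map. [folklore] -/
@[simp] theorem suffixSum_apply (u : Fin m → ℝ) (J : Fin m) :
    suffixSum m u J = ∑ a ∈ Finset.univ.filter (fun a : Fin m => J ≤ a), u a := by
  simp [suffixSum]

/-- The matrix of the suffix-sum map: `1` above and on the diagonal, `0` below. [folklore] -/
theorem toMatrix'_suffixSum (J a : Fin m) :
    LinearMap.toMatrix' (suffixSum m) J a = if J ≤ a then 1 else 0 := by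
  rw [LinearMap.toMatrix'_apply, suffixSum_apply]
  simp only [Pi.single_apply]
  rw [Finset.sum_ite_eq' (Finset.univ.filter fun a' : Fin m => J ≤ a') a (fun _ => (1 : ℝ))]
  simp

/-- The matrix of the suffix-sum map is upper triangular. [folklore] -/
theorem blockTriangular_suffixSum : (LinearMap.toMatrix' (suffixSum m)).BlockTriangular id := by
  intro J a h
  rw [toMatrix'_suffixSum]
  exact if_neg (not_le.2 h)

/-- **`det (suffixSum) = 1`.** [folklore] -/
theorem det_suffixSum : LinearMap.det (suffixSum m) = 1 := by
  rw [← LinearMap.det_toMatrix', det_of_upperTriangular (blockTriangular_suffixSum m)]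
  simp only [toMatrix'_suffixSum, le_refl, if_true, Finset.prod_const_one]

/-- The suffix-sum map as a continuous linear equivalence. [folklore] -/
def suffixSumEquiv : (Fin m → ℝ) ≃L[ℝ] (Fin m → ℝ) :=
  LinearEquiv.toContinuousLinearEquiv
    (LinearEquiv.ofIsUnitDet (f := suffixSum m) (v := Pi.basisFun ℝ (Fin m)) (v' := Pi.basisFun ℝ (Fin m))
      (by
        rw [LinearMap.toMatrix_eq_toMatrix', LinearMap.det_toMatrix', det_suffixSum]
        exact isUnit_one))

/-- The equivalence is the suffix-sum map. [folklore] -/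
@[simp] theorem suffixSumEquiv_apply (u : Fin m → ℝ) : suffixSumEquiv m u = suffixSum m u := rfl

/-- **The suffix-sum map preserves Lebesgue measure.** [folklore] -/
theorem measurePreserving_suffixSum :
    MeasurePreserving (suffixSum m) (volume : Measure (Fin m → ℝ)) volume := by
  refine ⟨(suffixSum m).continuous_of_finiteDimensional.measurable, ?_⟩
  have hdet : LinearMap.det (suffixSum m) ≠ 0 := by rw [det_suffixSum]; exact one_ne_zero
  rw [Measure.map_linearMap_addHaar_eq_smul_addHaar volume hdet, det_suffixSum]
  simp

/-- **Change of variables along the suffix-sum map**: `∫ f(S u) du = ∫ f(v) dv`. [folklore] -/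
theorem integral_comp_suffixSum {E : Type*} [NormedAddCommGroup E] [NormedSpace ℝ E] (f : (Fin m → ℝ) → E) :
    (∫ u, f (suffixSum m u)) = ∫ u, f u :=
  (measurePreserving_suffixSum m).integral_comp (suffixSumEquiv m).toHomeomorph.measurableEmbedding f

end Literature.Analysis.Matrix
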